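import Literature.NumberTheory.GaloisRepresentations.PowerSeriesTopNilpotentBasisFree
import Mathlib.LinearAlgebra.Dimension.Free
import Mathlib.LinearAlgebra.FreeModule.Finite.Basic
import Mathlib.LinearAlgebra.FreeModule.StrongRankCondition
import HarnessLib

/-!
# `S⟦Y⟧` as an honest `S⟦T⟧`-MODULE through a topologically nilpotent operator (`T ↦ D`): the type `TActModule D hD`,
# its module structure, the `Λ`-linear maps induced by operators commuting with `D`, and the BASIS `1, Y, …, Y^{d−1}`

De Shalit, *Iwasawa theory of elliptic curves with complex multiplication* (1987), Ch. I §3.1 ("`ℤ_p⟦𝒢⟧ = Λ[Δ]`, `Λ ≅ ℤ_p⟦S⟧`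
… maps `u^α` to `(1+S)^α`"), §3.7–3.8 (the semi-local units as a `Λ`-module); Washington, *Introduction to Cyclotomic Fields* §13.2
(a compact `ℤ_p⟦Γ⟧`-module is a `Λ = ℤ_p⟦T⟧`-module through `T = γ − 1`).  The tree already has the ACTION as explicit identities
(`PowerSeriesTopNilpotentAction`: `tAct D hD c r = Σ_k c_k D^k r` with `tAct_add_left/right`, `tAct_mul`, `tAct_one`, `tAct_C`, `tAct_X`)
and its FREENESS as a unique-representation statement (`PowerSeriesTopNilpotentBasisFree.existsUnique_basisMap`: every `V` is uniquely
`Σ_{j<d} c_j·Y^j` when `D(Y^k) ≡ Y^{k+d} (mod p, Y^{k+d+1})`).  The consumers of the Coleman-series structure theorem — characteristic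
ideals (`Module.charIdeal`), finite generation / torsion (`Module.Finite`, `Module.IsTorsion`), the pinned datum `SemilocalUnitData₂` —
are phrased for Mathlib MODULES.  THIS file is the (generic, elementary) packaging:

* `TActModule D hD` — a type synonym of `PowerSeries S` (kept apart from `PowerSeries S` because the latter is already a module over
  itself by multiplication), with `AddCommGroup` and **`Module (PowerSeries S) (TActModule D hD)`, `c • r := tAct D hD c r`**;
  `ofPS`/`toPS` the identifications; `smul_def`, `X_smul` (`T • r = D r`), `C_smul`, `X_pow_smul`, `one_add_X_pow_smul`
  (`(1+T)^n • r = (1 + D)^n r`);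
* ★ `tAct_comm_of_commute` / **`TActModule.linearOfCommute`** — an `S`-linear operator `L` of `S⟦Y⟧` that commutes with `D` and
  preserves the `(p, Y)`-adic filtration is `S⟦T⟧`-LINEAR on `TActModule D hD` (this is how the Galois/Frobenius operators of the Coleman
  coordinate module become `Λ`-module endomorphisms);
* ★★ **`TActModule.basis`** — under the triangularity hypothesis of `PowerSeriesTopNilpotentBasisFree` (`D(Y^k) − Y^{k+d} ∈ J_{k+d+1}`,
  `p` a non-zero-divisor, `S` `(p)`-adically complete) the family `j ↦ Y^j`, `j < d`, is a `Module.Basis (Fin d) (PowerSeries S) (TActModule D hD)`;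
  hence `Module.Free`, `Module.Finite` and **`Module.finrank (PowerSeries S) (TActModule D hD) = d`**.

Everything PROVED (0 sorry, no named facts).  Definitions: `TActModule` (type synonym), `TActModule.ofPS`/`toPS` (the identity
equivalences), the `Module` instance (on the NEW type only — no Mathlib instance is overridden), `TActModule.linearOfCommute`,
`TActModule.basisFun`, `TActModule.basis`.  NOT here: any Lubin–Tate specifics (the sequel `LubinTateColemanCoordModuleTwo` instantiates
`D = D_γ = σ_γ − 1` on the Coleman coordinates at `q = 2`).

## References

* E. de Shalit, *Iwasawa theory of elliptic curves with complex multiplication* (1987), Ch. I §3.1, §3.7–3.8. [deShalit1987]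
* L. C. Washington, *Introduction to Cyclotomic Fields*, 2nd ed. (1997), §7.1, §13.2. [Washington1997]
-/

noncomputable section

namespace Literature.NumberTheory.GaloisRepresentations

namespace LubinTate

open Finset

variable {S : Type*} [CommRing S] {p : S}

/-! ### The type synonym and its module structure -/

/-- **`TActModule D hD`**: the additive group `S⟦Y⟧` regarded as an `S⟦T⟧`-module through `T ↦ D` (`c • r = Σ_k c_k D^k r`), for an
`S`-linear `D` with `D(I_N) ⊆ I_{N+1}`.  A type synonym of `PowerSeries S` (which is itself already an `S⟦Y⟧`-module by multiplication,
whence the separate type). [cite: Washington1997, §13.2] -/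
@[nolint unusedArguments]
def TActModule (D : PowerSeries S →ₗ[S] PowerSeries S)
    (_hD : ∀ N (r : PowerSeries S), r ∈ adicFiltGen p N → D r ∈ adicFiltGen p (N + 1)) : Type _ :=
  PowerSeries S

namespace TActModule

variable {D : PowerSeries S →ₗ[S] PowerSeries S}
  {hD : ∀ N (r : PowerSeries S), r ∈ adicFiltGen p N → D r ∈ adicFiltGen p (N + 1)}

/-- The additive group structure of `S⟦Y⟧`. [folklore] -/
instance instAddCommGroup : AddCommGroup (TActModule D hD) := inferInstanceAs (AddCommGroup (PowerSeries S))

variable (D hD) in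
/-- The identification `S⟦Y⟧ ≃+ TActModule D hD` (the identity). [folklore] -/
def ofPS : PowerSeries S ≃+ TActModule D hD := AddEquiv.refl _

/-- The identification `TActModule D hD ≃+ S⟦Y⟧` (the identity). [folklore] -/
def toPS : TActModule D hD ≃+ PowerSeries S := AddEquiv.refl _

/-- `toPS (ofPS r) = r`. [cite: Washington1997, §13.2] -/
@[simp] theorem toPS_ofPS (r : PowerSeries S) : toPS (ofPS D hD r) = r := rfl

/-- `ofPS (toPS r) = r`. [cite: Washington1997, §13.2] -/
@[simp] theorem ofPS_toPS (r : TActModule D hD) : ofPS D hD (toPS r) = r := rfl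

/-- `ofPS` is injective. [cite: Washington1997, §13.2] -/
theorem ofPS_injective : Function.Injective (ofPS D hD) := fun _ _ h => h

/-- `toPS` is injective. [cite: Washington1997, §13.2] -/
theorem toPS_injective : Function.Injective (toPS : TActModule D hD → PowerSeries S) := fun _ _ h => h

variable [IsAdicComplete (Ideal.span {p}) S]

/-- The scalar multiplication `c • r := c(T)·r = Σ_k c_k D^k r`. [cite: Washington1997, §13.2] -/
instance instSMul : SMul (PowerSeries S) (TActModule D hD) := ⟨fun c r => ofPS D hD (tAct D hD c (toPS r))⟩

/-- Unfolding the scalar multiplication. [cite: Washington1997, §13.2] -/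
theorem smul_def (c : PowerSeries S) (r : TActModule D hD) : c • r = ofPS D hD (tAct D hD c (toPS r)) := rfl

/-- `toPS (c • r) = c(T)·(toPS r)`. [cite: Washington1997, §13.2] -/
theorem toPS_smul (c : PowerSeries S) (r : TActModule D hD) : toPS (c • r) = tAct D hD c (toPS r) := rfl

/-- `c • ofPS r = ofPS (c(T)·r)`. [cite: Washington1997, §13.2] -/
theorem smul_ofPS (c r : PowerSeries S) : c • ofPS D hD r = ofPS D hD (tAct D hD c r) := rfl

/-- **`TActModule D hD` is an `S⟦T⟧`-module** (the axioms are `tAct_one`, `tAct_mul`, `tAct_add_left/right`).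
[cite: Washington1997, §13.2] -/
instance instModule : Module (PowerSeries S) (TActModule D hD) where
  one_smul r := by
    change ofPS D hD (tAct D hD 1 (toPS r)) = r
    rw [tAct_one]; rfl
  mul_smul c c' r := by
    change ofPS D hD (tAct D hD (c * c') (toPS r)) = ofPS D hD (tAct D hD c (tAct D hD c' (toPS r)))
    rw [tAct_mul]
  smul_add c r r' := by
    change ofPS D hD (tAct D hD c (toPS r + toPS r')) = ofPS D hD (tAct D hD c (toPS r)) + ofPS D hD (tAct D hD c (toPS r'))
    rw [tAct_add_right]; rfl
  smul_zero c := by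
    have h : tAct D hD c (0 + 0) = tAct D hD c 0 + tAct D hD c 0 := tAct_add_right hD c 0 0
    rw [add_zero] at h
    change ofPS D hD (tAct D hD c 0) = ofPS D hD 0
    rw [left_eq_add.mp h]
  add_smul c c' r := by
    change ofPS D hD (tAct D hD (c + c') (toPS r)) = ofPS D hD (tAct D hD c (toPS r)) + ofPS D hD (tAct D hD c' (toPS r))
    rw [tAct_add_left]; rfl
  zero_smul r := by
    change ofPS D hD (tAct D hD 0 (toPS r)) = ofPS D hD 0
    rw [← map_zero PowerSeries.C, tAct_C, map_zero, zero_mul]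

/-- ★ **`T • r = D r`**. [cite: Washington1997, §13.2] -/
theorem X_smul (r : TActModule D hD) : (PowerSeries.X : PowerSeries S) • r = ofPS D hD (D (toPS r)) := by
  rw [smul_def, tAct_X]

/-- **`(C a) • r = a·r`**: constants act by multiplication. [cite: Washington1997, §13.2] -/
theorem C_smul (a : S) (r : TActModule D hD) : (PowerSeries.C a : PowerSeries S) • r = ofPS D hD (PowerSeries.C a * toPS r) := by
  rw [smul_def, tAct_C]

/-- `T^k • r = D^k r`. [cite: Washington1997, §13.2] -/
theorem X_pow_smul (k : ℕ) (r : TActModule D hD) : (PowerSeries.X ^ k : PowerSeries S) • r = ofPS D hD ((⇑D)^[k] (toPS r)) := by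
  induction k generalizing r with
  | zero => rw [pow_zero, one_smul, Function.iterate_zero_apply]; rfl
  | succ k ih => rw [pow_succ', mul_smul, ih, X_smul, Function.iterate_succ_apply']; rfl

/-- ★ **`(1+T)^n • r = (1 + D)^n r`** — a group element `γ^n` (`γ ↦ 1 + T`) acts through the `n`-th iterate of `σ = 1 + D`.
[cite: deShalit1987, Ch. I §3.1] -/
theorem one_add_X_pow_smul (n : ℕ) (r : TActModule D hD) :
    ((1 + PowerSeries.X) ^ n : PowerSeries S) • r = ofPS D hD ((fun s => s + D s)^[n] (toPS r)) := by
  induction n generalizing r with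
  | zero => rw [pow_zero, one_smul, Function.iterate_zero_apply]; rfl
  | succ n ih => rw [pow_succ', mul_smul, ih, add_smul, one_smul, X_smul, Function.iterate_succ_apply']; rfl

/-- **Continuity of the action in `r`**: `toPS r ∈ I_N ⟹ toPS (c • r) ∈ I_N`. [cite: Washington1997, §13.2] -/
theorem toPS_smul_mem_adicFiltGen (c : PowerSeries S) {N : ℕ} {r : TActModule D hD} (hr : toPS r ∈ adicFiltGen p N) :
    toPS (c • r) ∈ adicFiltGen p N :=
  tAct_mem_adicFiltGen hD c hr

/-! ### Operators commuting with `D` are `S⟦T⟧`-linear -/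

omit [IsAdicComplete (Ideal.span {p}) S] in
/-- An `S`-linear `L` commuting with `D` commutes with the iterates of `D`. [cite: Washington1997, §13.2] -/
theorem iterate_comm_of_commute {L : PowerSeries S →ₗ[S] PowerSeries S} (hLD : ∀ r, L (D r) = D (L r)) (k : ℕ) (r : PowerSeries S) :
    (⇑D)^[k] (L r) = L ((⇑D)^[k] r) := by
  induction k generalizing r with
  | zero => rfl
  | succ k ih => rw [Function.iterate_succ_apply, Function.iterate_succ_apply, ← hLD, ih]

omit [IsAdicComplete (Ideal.span {p}) S] in
/-- An `S`-linear `L` commuting with `D` commutes with the partial sums `Σ_{k<K} c_k D^k`. [cite: Washington1997, §13.2] -/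
theorem tPartial_comm_of_commute {L : PowerSeries S →ₗ[S] PowerSeries S} (hLD : ∀ r, L (D r) = D (L r)) (c r : PowerSeries S) (K : ℕ) :
    tPartial D c (L r) K = L (tPartial D c r K) := by
  rw [tPartial_def, tPartial_def, map_sum]
  refine sum_congr rfl fun k _ => ?_
  rw [iterate_comm_of_commute hLD, ← PowerSeries.smul_eq_C_mul, ← PowerSeries.smul_eq_C_mul, map_smul]

/-- ★ **An `S`-linear operator commuting with `D` and preserving the filtration commutes with the whole action**:
`c(T)·(L r) = L (c(T)·r)`. [cite: deShalit1987, Ch. I §3.4 Lemma (ii), §3.7] -/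
theorem tAct_comm_of_commute {L : PowerSeries S →ₗ[S] PowerSeries S} (hLD : ∀ r, L (D r) = D (L r))
    (hL : ∀ N (r : PowerSeries S), r ∈ adicFiltGen p N → L r ∈ adicFiltGen p N) (c r : PowerSeries S) :
    tAct D hD c (L r) = L (tAct D hD c r) := by
  symm
  refine eq_tAct_of_forall_sub_mem hD fun K => ?_
  rw [tPartial_comm_of_commute hLD, ← map_sub]
  exact hL K _ (tAct_sub_tPartial_mem hD c r K)

variable (D hD) in
/-- ★ **`TActModule.linearOfCommute`**: an `S`-linear `L` with `L ∘ D = D ∘ L` and `L(I_N) ⊆ I_N` as an `S⟦T⟧`-LINEAR endomorphism of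
`TActModule D hD`. [cite: deShalit1987, Ch. I §3.4 Lemma (ii), §3.7] -/
def linearOfCommute (L : PowerSeries S →ₗ[S] PowerSeries S) (hLD : ∀ r, L (D r) = D (L r))
    (hL : ∀ N (r : PowerSeries S), r ∈ adicFiltGen p N → L r ∈ adicFiltGen p N) :
    TActModule D hD →ₗ[PowerSeries S] TActModule D hD where
  toFun r := ofPS D hD (L (toPS r))
  map_add' r r' := by
    change ofPS D hD (L (toPS r + toPS r')) = _
    rw [map_add]; rfl
  map_smul' c r := by
    change ofPS D hD (L (tAct D hD c (toPS r))) = ofPS D hD (tAct D hD c (L (toPS r)))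
    rw [tAct_comm_of_commute hLD hL]

/-- Unfolding `linearOfCommute`. [cite: deShalit1987, Ch. I §3.7] -/
@[simp] theorem toPS_linearOfCommute_apply (L : PowerSeries S →ₗ[S] PowerSeries S) (hLD : ∀ r, L (D r) = D (L r))
    (hL : ∀ N (r : PowerSeries S), r ∈ adicFiltGen p N → L r ∈ adicFiltGen p N) (r : TActModule D hD) :
    toPS (linearOfCommute D hD L hLD hL r) = L (toPS r) := rfl

/-- `linearOfCommute L (ofPS r) = ofPS (L r)`. [cite: deShalit1987, Ch. I §3.7] -/
theorem linearOfCommute_ofPS (L : PowerSeries S →ₗ[S] PowerSeries S) (hLD : ∀ r, L (D r) = D (L r))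
    (hL : ∀ N (r : PowerSeries S), r ∈ adicFiltGen p N → L r ∈ adicFiltGen p N) (r : PowerSeries S) :
    linearOfCommute D hD L hLD hL (ofPS D hD r) = ofPS D hD (L r) := rfl

/-- `D` itself qualifies: the `S⟦T⟧`-linear map `r ↦ D r` is `r ↦ T • r`. [cite: Washington1997, §13.2] -/
theorem linearOfCommute_self_apply (r : TActModule D hD) :
    linearOfCommute D hD D (fun _ => rfl) (fun N r hr => adicFiltGen_mono (Nat.le_succ N) (hD N r hr)) r =
      (PowerSeries.X : PowerSeries S) • r := by
  rw [X_smul]; rfl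

/-! ### The basis `1, Y, …, Y^{d−1}` -/

variable {d : ℕ}

variable (D hD d) in
/-- The candidate basis vectors `Y^j`, `j < d`, of `TActModule D hD`. [cite: deShalit1987, Ch. I §3.1] -/
def basisFun (j : Fin d) : TActModule D hD := ofPS D hD (PowerSeries.X ^ (j : ℕ))

omit [IsAdicComplete (Ideal.span {p}) S] in
/-- `toPS (basisFun j) = Y^j`. [cite: deShalit1987, Ch. I §3.1] -/
@[simp] theorem toPS_basisFun (j : Fin d) : toPS (basisFun D hD d j) = PowerSeries.X ^ (j : ℕ) := rfl

/-- **The tree's `basisMap` is the linear combination `Σ_j c_j • Y^j`** in the module `TActModule D hD`.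
[cite: deShalit1987, Ch. I §3.1] -/
theorem ofPS_basisMap (c : ℕ → PowerSeries S) :
    ofPS D hD (basisMap D hD d c) = ∑ j : Fin d, c j • basisFun D hD d j := by
  apply toPS_injective
  rw [toPS_ofPS, basisMap_def, ← Fin.sum_univ_eq_sum_range, map_sum]
  rfl

/-- A coefficient vector `g : Fin d → S⟦T⟧` extended by zero to `ℕ → S⟦T⟧` (the indexing of the tree's `basisMap`). [folklore] -/
def extendByZero (g : Fin d → PowerSeries S) : ℕ → PowerSeries S := fun j => if h : j < d then g ⟨j, h⟩ else 0

omit [IsAdicComplete (Ideal.span {p}) S] in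
/-- `extendByZero g j = g j` for `j < d`. [cite: deShalit1987, Ch. I §3.1] -/
@[simp] theorem extendByZero_apply (g : Fin d → PowerSeries S) (j : Fin d) : extendByZero g j = g j := by
  rw [extendByZero, dif_pos j.isLt]

omit [IsAdicComplete (Ideal.span {p}) S] in
/-- `extendByZero g j = 0` for `d ≤ j`. [cite: deShalit1987, Ch. I §3.1] -/
theorem extendByZero_of_le (g : Fin d → PowerSeries S) {j : ℕ} (hj : d ≤ j) : extendByZero g j = 0 := by
  rw [extendByZero, dif_neg (not_lt.mpr hj)]

/-- `Σ_j g_j • Y^j = ofPS (basisMap (extendByZero g))`. [cite: deShalit1987, Ch. I §3.1] -/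
theorem sum_smul_basisFun_eq (g : Fin d → PowerSeries S) :
    ∑ j : Fin d, g j • basisFun D hD d j = ofPS D hD (basisMap D hD d (extendByZero g)) := by
  rw [ofPS_basisMap]
  exact Fintype.sum_congr _ _ fun j => by rw [extendByZero_apply]

variable (hT : ∀ k : ℕ, D (PowerSeries.X ^ k) - PowerSeries.X ^ (k + d) ∈ degFilt p (k + d + 1))

include hT in
/-- ★ **Linear independence of `1, Y, …, Y^{d−1}` over `S⟦T⟧`** (`eq_zero_of_basisMap_eq_zero`). [cite: deShalit1987, Ch. I §3.1, §3.7] -/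
theorem linearIndependent_basisFun (hd : 0 < d) (hp : ∀ x : S, p * x = 0 → x = 0) :
    LinearIndependent (PowerSeries S) (basisFun D hD d) := by
  rw [Fintype.linearIndependent_iff]
  intro g hg j
  rw [sum_smul_basisFun_eq] at hg
  have h0 : basisMap D hD d (extendByZero g) = 0 := ofPS_injective hg
  rw [← extendByZero_apply g j]
  exact eq_zero_of_basisMap_eq_zero hD hT hd hp h0 j.isLt

include hT in
/-- ★ **`1, Y, …, Y^{d−1}` span `TActModule D hD` over `S⟦T⟧`** (`exists_basisMap_eq`). [cite: deShalit1987, Ch. I §3.1, §3.7] -/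
theorem span_basisFun_eq_top (hd : 0 < d) : Submodule.span (PowerSeries S) (Set.range (basisFun D hD d)) = ⊤ := by
  refine Submodule.eq_top_iff'.mpr fun V => ?_
  obtain ⟨c, hc⟩ := exists_basisMap_eq hD hT hd (toPS V)
  have hV : V = ∑ j : Fin d, c j • basisFun D hD d j := by rw [← ofPS_basisMap, hc]; rfl
  rw [hV]
  exact Submodule.sum_mem _ fun j _ => Submodule.smul_mem _ _ (Submodule.subset_span (Set.mem_range_self j))

variable (D hD d) in
include hT in
/-- ★★ **THE BASIS**: `TActModule D hD` is free over `S⟦T⟧` with basis `j ↦ Y^j` (`j < d`), for `S` `(p)`-adically complete, `p` a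
non-zero-divisor, `D(I_N) ⊆ I_{N+1}` and `D(Y^k) ≡ Y^{k+d} (mod p, Y^{k+d+1})`. [cite: deShalit1987, Ch. I §3.1, §3.7] -/
def basis (hd : 0 < d) (hp : ∀ x : S, p * x = 0 → x = 0) : Module.Basis (Fin d) (PowerSeries S) (TActModule D hD) :=
  Module.Basis.mk (linearIndependent_basisFun hT hd hp) (span_basisFun_eq_top hT hd).ge

/-- The basis vectors are the `Y^j`. [cite: deShalit1987, Ch. I §3.1] -/
@[simp] theorem basis_apply (hd : 0 < d) (hp : ∀ x : S, p * x = 0 → x = 0) (j : Fin d) :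
    basis D hD d hT hd hp j = basisFun D hD d j := by
  rw [basis, Module.Basis.mk_apply]

/-- `⇑(basis …) = basisFun`. [cite: deShalit1987, Ch. I §3.1] -/
theorem coe_basis (hd : 0 < d) (hp : ∀ x : S, p * x = 0 → x = 0) : ⇑(basis D hD d hT hd hp) = basisFun D hD d :=
  Module.Basis.coe_mk _ _

/-- **The coordinates of `ofPS (basisMap c)` in the basis are the `c_j`** (`j < d`). [cite: deShalit1987, Ch. I §3.1] -/
theorem basis_repr_ofPS_basisMap (hd : 0 < d) (hp : ∀ x : S, p * x = 0 → x = 0) (c : ℕ → PowerSeries S) (j : Fin d) :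
    (basis D hD d hT hd hp).repr (ofPS D hD (basisMap D hD d c)) j = c j := by
  have e : ofPS D hD (basisMap D hD d c) = ∑ i : Fin d, c i • basis D hD d hT hd hp i := by
    rw [ofPS_basisMap]
    exact Fintype.sum_congr _ _ fun i => by rw [basis_apply]
  rw [e, (basis D hD d hT hd hp).repr_sum_self]

include hT in
/-- `TActModule D hD` is a free `S⟦T⟧`-module. [cite: deShalit1987, Ch. I §3.7] -/
theorem free (hd : 0 < d) (hp : ∀ x : S, p * x = 0 → x = 0) : Module.Free (PowerSeries S) (TActModule D hD) :=
  Module.Free.of_basis (basis D hD d hT hd hp)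

include hT in
/-- `TActModule D hD` is a finitely generated `S⟦T⟧`-module. [cite: deShalit1987, Ch. I §3.7] -/
theorem finite (hd : 0 < d) (hp : ∀ x : S, p * x = 0 → x = 0) : Module.Finite (PowerSeries S) (TActModule D hD) :=
  Module.Finite.of_basis (basis D hD d hT hd hp)

include hT in
/-- ★★ **`rank_{S⟦T⟧} TActModule D hD = d`** (`S` nontrivial). [cite: deShalit1987, Ch. I §3.7] -/
theorem finrank_eq [Nontrivial S] (hd : 0 < d) (hp : ∀ x : S, p * x = 0 → x = 0) :
    Module.finrank (PowerSeries S) (TActModule D hD) = d := by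
  rw [Module.finrank_eq_card_basis (basis D hD d hT hd hp), Fintype.card_fin]

/-- **Every element is `Σ_j (repr_j) • Y^j`** (the basis expansion, restated on `toPS`: `toPS r = basisMap (repr r)`).
[cite: deShalit1987, Ch. I §3.1] -/
theorem toPS_eq_basisMap_repr (hd : 0 < d) (hp : ∀ x : S, p * x = 0 → x = 0) (r : TActModule D hD) :
    toPS r = basisMap D hD d (extendByZero fun j => (basis D hD d hT hd hp).repr r j) := by
  have h := (basis D hD d hT hd hp).sum_repr r
  apply ofPS_injective
  rw [ofPS_toPS, ← sum_smul_basisFun_eq]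
  conv_lhs => rw [← h]
  exact Fintype.sum_congr _ _ fun j => by rw [basis_apply]

end TActModule

end LubinTate

end Literature.NumberTheory.GaloisRepresentations
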